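import Summits.QuantumFields.BalabanUV.Beta.GAN24.WSlotSupRate
import Summits.QuantumFields.BalabanUV.Beta.GAN24.StencilSlotWallPlug
import Summits.QuantumFields.BalabanUV.Beta.GAN24.StencilSlotSAllThree

/-!
# `BalabanUV.Beta.GAN24.WSlotSupRateWall` — binder row G-an2-4 / (CONV-C) at the D1 WALL, `d = 3`, `Lc ≥ 2`: THE WALL ⟺ THE IDENTIFICATION
# FROM THE S-BLOCK, THE UNIFORM W-ROW `hW` AND AN ENTRYWISE ONE-STEP SUP-NORM RATE OF THE NORMALISED SECOND-ORDER TABLES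
# (G-an2-4 FORMAL swarm, leaf-01 lineage, gen 13; part 2 of «W-SLOT-SUPRATE*»)

NOT IN PRINT; OUR PROOF ATTEMPT.  HONEST FRAMING (cell contract, verbatim): «discharging `BetaPertH` makes Bałaban's UV stability
UNCONDITIONAL — a real constructive-QFT result; it is NOT the continuum limit and NOT the Clay problem.»  HONEST DEPENDENCY (verbatim):
«continuum YM on T⁴ ⇐ BetaPertH ∧ nine spine estimates (0/9 proved); BetaPertH ⇐ (D1) ∧ (D4) ∧ CAP+tail; G-an2-4 gates asym, D1 and
NE2/3/4.»

WHAT.  asym1's wall theorem `HessKerConvCKPlug.d1Drift_JsBalOf_iff_of_convCKWall` turns the D1 wall for the Bałaban jets `JsBalOf` into the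
identification `secondMoment (dressed limit kernels) μ ν = stepBal N Lc`, given four binder families in the one-step units
`(sfStep Lc j, smStep 3 Lc j) = (Lc^j, Lc^{4j})`: the K-rows — tree theorems since gen 3 (`KSlotAssembly.convCKWall_holds`); the S-rows `(hS, hSall)`;
and an2's two W-rows `hW` (UNIFORM) and `hWall` (CAUCHY).  Part 1 (`WSlotSupRate.hW_hWall_step_of_hW_supRate`) reduces `hWall` to `hW` plus an
entrywise one-step SUP-NORM rate of the normalised tables.  This module composes the two BY NAME:

* **`d1Drift_JsBalOf_iff_three_of_sBlock_hW_supRate`** — for ANY second-order table family `W` (its raw per-`j` localisation data only NAME the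
  jets): given the S-BLOCK `hSS : ∃ Cs cS θS δS, 0 ≤ θS ∧ θS < 1 ∧ 0 < δS ∧ hS ∧ hSall` (ONE packaged hypothesis — at `d = 3`, `Lc ≥ 2` it is the
  CONCLUSION of the row owner's `StencilSlotSAllThree.hS_hSall_three_of_diffRows` fed with the three landed DIFFERENCE rows
  `TaylorRowDWThree.rowDW_three` ∕ `S3DiffV.diffV_three` ∕ `S3DiffL.diffL_three`, i.e. of his `StencilSlotSAllThree.hS_hSall_three` (v1.1, at the gate
  when this file was written) — supplied by `exact`, nothing to repackage), the UNIFORM W-row `hW₂ : ∀ j, VertexFamily₂ (unitW (Lc^j) (Lc^{4j}) (W j)) Lc Cw δW`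
  (`0 < δW`) and the entrywise one-step sup-norm rate `|W♮ (j+1) μ y ν y′ x z a b − W♮ j μ y ν y′ x z a b| ≤ c·θ^j` (`0 ≤ c`, `0 ≤ θ < 1`) of
  `W♮ j := unitW (Lc^j) (Lc^{4j}) (W j)`, the wall `D1Drift Lc (JsBalOf … W …) N μ ν` is EQUIVALENT to
  `secondMoment (hessKer (axDressK Lc K∞) (axVertexOfK K∞ Lc S∞) W∞) μ ν = stepBal N Lc` at the constructed limits of the normalised primitives.
  With `hSS` a tree theorem, the W uniform row and the W sup-rate are the ONLY analytic hypotheses left at the wall.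

[folklore] composition, every input BY NAME: `KSlotAssembly.convCKWall_holds` (carver∕gan24-p1; inside: road «P1»),
`WSlotSupRate.hW_hWall_step_of_hW_supRate` (part 1), `HessKerConvCKPlug.d1Drift_JsBalOf_iff_of_convCKWall` (asym1).

HONEST: conditional on `hSS` (a tree theorem at `d = 3` once `StencilSlotSAllThree` v1.1 lands; until then dischargeable by name from the three
landed DIFFERENCE rows) and on the two W-hypotheses (an2, road P4: for `W := WbalOf …` the uniform row waits on «T2Shape» — leaf-07's
`WSlotOfShapes.hW_of_shapes` — and the sup-rate on «T2SupRate»-type estimates of the normalised recursive tables; NOT IN PRINT, OPEN); the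
identification on the right is row D1's object, asserted nowhere; discharges NOTHING new by itself; NOT «W-slot closed», NEVER «G-an2-4 closed»,
NOT (CONV-C); NOT BetaPertH, NOT continuum, NOT Clay.
-/

noncomputable section

open Literature.MathematicalPhysics.QuantumFieldTheory
open Literature.MathematicalPhysics.QuantumFieldTheory.Balaban1983to89
open Literature.MathematicalPhysics.QuantumFieldTheory.Balaban1983to89.Beta
open ExpKernelCalculus (MKer VertexFamily₂ hessKer)
open OneStepResolventKernel (Fib LocStencil)
open OneStepKernelFamily (KInvStep D1Drift)
open AxialDressing (axDressK axVertexOfK)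
open BalabanStepJetsSucc (JsBal0Of JsBalOf)
open HessKerDressedLimit (limMKerOf limStOf limTabOf)
open Summit.QuantumFields.BalabanUV.Beta.HessKerDressedUnits (unitK unitS unitW)
open Summit.QuantumFields.BalabanUV.Beta.HessKerConvCKPlug (d1Drift_JsBalOf_iff_of_convCKWall)
open Summit.QuantumFields.BalabanUV.Beta.GAN24.CombesThomas (SupBound sfStep smStep)
open Summit.QuantumFields.BalabanUV.Beta.GAN24.KSlotAssembly (convCKWall_holds)
open Summit.QuantumFields.BalabanUV.Beta.GAN24.StencilSlotOfE3 (one_le_of_two_le)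
open Summit.QuantumFields.BalabanUV.Beta.GAN24.WSlotSupRate (hW_hWall_step_of_hW_supRate)
open Summit.QuantumFields.BalabanUV.Beta.GAN24.StencilSlotSAllThree (hS_hSall_three)

namespace Summit.QuantumFields.BalabanUV.Beta.GAN24.WSlotSupRateWall

variable {Lc : ℕ} [NeZero Lc]

/-- **THE D1 WALL ⟺ THE IDENTIFICATION AT `d = 3`, `Lc ≥ 2`, FROM THE S-BLOCK, THE UNIFORM W-ROW AND THE W SUP-RATE** [folklore] composition
(K-rows `KSlotAssembly.convCKWall_holds`; S-block `hSS` = ONE packaged hypothesis, the conclusion of the row owner's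
`StencilSlotSAllThree.hS_hSall_three_of_diffRows` ∕ `hS_hSall_three` supplied by `exact`; W Cauchy row from `WSlotSupRate.hW_hWall_step_of_hW_supRate`;
socket `HessKerConvCKPlug.d1Drift_JsBalOf_iff_of_convCKWall`): for ANY table family `W` whose normalised members `unitW (Lc^j) (Lc^{4j}) (W j)` are
`j`-uniformly bi-localised (`hW₂`, `0 < δW`) and converge entrywise at a one-step sup-norm rate `c·θ^j` (`0 ≤ c`, `0 ≤ θ < 1`), the wall
`D1Drift Lc (JsBalOf … W …) N μ ν` is EQUIVALENT to the identification of the second moment of the dressed limit kernel with `stepBal N Lc`.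
The identification is row D1's (asserted nowhere). -/
theorem d1Drift_JsBalOf_iff_three_of_sBlock_hW_supRate (hLc : 2 ≤ Lc) (cE cVH cΛ : ℝ)
    (W : ℕ → Fin (3 + 1) → (Fin (3 + 1) → ℤ) → Fin (3 + 1) → (Fin (3 + 1) → ℤ) → MKer (3 + 1) (Fib 3))
    (Cw' δw : ℕ → ℝ) (hδw : ∀ j, 0 < δw j) (hW' : ∀ j, VertexFamily₂ (W j) Lc (Cw' j) (δw j))
    (hSS : ∃ Cs cS θS δS : ℝ, 0 ≤ θS ∧ θS < 1 ∧ 0 < δS ∧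
      (∀ j, LocStencil (unitS (sfStep Lc j) (smStep 3 Lc j) (JsBal0Of (one_le_of_two_le hLc) cE cVH cΛ W Cw' δw hδw hW' j).S) Cs δS) ∧
      (∀ k j, LocStencil (unitS (sfStep Lc (k + j)) (smStep 3 Lc (k + j))
          (JsBal0Of (one_le_of_two_le hLc) cE cVH cΛ W Cw' δw hδw hW' (k + j)).S -
        unitS (sfStep Lc k) (smStep 3 Lc k) (JsBal0Of (one_le_of_two_le hLc) cE cVH cΛ W Cw' δw hδw hW' k).S) (cS * θS ^ k) δS))
    {Cw δW c θ : ℝ}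
    (hW₂ : ∀ j, VertexFamily₂ (unitW (sfStep Lc j) (smStep 3 Lc j) (W j)) Lc Cw δW)
    (hR : ∀ (j : ℕ) (μ : Fin (3 + 1)) (y : Fin (3 + 1) → ℤ) (ν : Fin (3 + 1)) (y' : Fin (3 + 1) → ℤ),
      SupBound (unitW (sfStep Lc (j + 1)) (smStep 3 Lc (j + 1)) (W (j + 1)) μ y ν y' -
        unitW (sfStep Lc j) (smStep 3 Lc j) (W j) μ y ν y') (c * θ ^ j))
    (hc : 0 ≤ c) (hθ0 : 0 ≤ θ) (hθ1 : θ < 1) (hδW : 0 < δW) (μ ν : Fin 4) (N : ℝ) :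
    D1Drift Lc (JsBalOf (one_le_of_two_le hLc) cE cVH cΛ W Cw' δw hδw hW') N μ ν ↔
      B12Beta.secondMoment (hessKer (axDressK Lc (limMKerOf fun j => unitK (sfStep Lc j) (smStep 3 Lc j) (KInvStep (d := 3) Lc j)))
        (axVertexOfK (limMKerOf fun j => unitK (sfStep Lc j) (smStep 3 Lc j) (KInvStep (d := 3) Lc j)) Lc
          (limStOf fun j => unitS (sfStep Lc j) (smStep 3 Lc j) (JsBal0Of (one_le_of_two_le hLc) cE cVH cΛ W Cw' δw hδw hW' j).S))
        (limTabOf fun j => unitW (sfStep Lc j) (smStep 3 Lc j) (W j))) μ ν = B12Normalization.stepBal N Lc := by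
  obtain ⟨Cs, cS, θS, δS, hθS0, hθS1, hδS, hS, hSall⟩ := hSS
  obtain ⟨Cw₂, cW, δW', θW, hδW', hθW0, hθW1, hW, hWall⟩ := hW_hWall_step_of_hW_supRate (Lc := Lc) W hW₂ hR hc hθ0 hθ1 hδW
  exact d1Drift_JsBalOf_iff_of_convCKWall (one_le_of_two_le hLc) cE cVH cΛ W Cw' δw hδw hW' (convCKWall_holds hLc) hS hSall hW hWall
    hδS hδW' hθS0 hθS1 hθW0 hθW1 μ ν N

/-! ## v1.1 APPENDIX (staged gen 14, filed gen 23 once p209285 was ACCEPTED): the owner's unconditional S-slot `StencilSlotSAllThree.hS_hSall_three` landed — the S-block of v1 discharged -/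

/-- **THE D1 WALL ⟺ THE IDENTIFICATION AT `d = 3`, `Lc ≥ 2`, FROM THE UNIFORM W-ROW AND ONE W SUP-RATE ALONE** (v1.1).  v1's
`d1Drift_JsBalOf_iff_three_of_sBlock_hW_supRate` with its S-block `hSS` DISCHARGED by the row owner's unconditional S-slot theorem
`StencilSlotSAllThree.hS_hSall_three` (gan24-p1, v1.1 p209285: the twelve rows BY NAME, the three DIFFERENCE rows
`TaylorRowDWThree.rowDW_three` ∕ `S3DiffV.diffV_three` ∕ `S3DiffL.diffL_three` last): for ANY second-order table family `W` (its raw per-`j` data `(Cw', δw, hδw, hW')` only NAME the jets `JsBalOf`), if the normalised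
members `W♮ j := unitW (Lc^j) (Lc^{4j}) (W j)` are `j`-uniformly bi-localised (`hW₂`, `0 < δW`) and converge ENTRYWISE at a one-step sup-norm rate
`|W♮ (j+1) … − W♮ j …| ≤ c·θ^j` (`0 ≤ c`, `0 ≤ θ < 1`), then the wall `D1Drift Lc (JsBalOf … W …) N μ ν` is EQUIVALENT to the identification
`secondMoment (hessKer (axDressK Lc K∞) (axVertexOfK K∞ Lc S∞) W∞) μ ν = stepBal N Lc` at the constructed limits of the normalised primitives —
the K-rows (`KSlotAssembly.convCKWall_holds`) and the S-rows (the twelve analytic rows of road «S3») being tree theorems.  HONEST: [folklore]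
composition; conditional on the two W-hypotheses only (for an2's `W := WbalOf …`: `hW₂` ⇐ «T2Shape» ∧ mixed-table shape — leaf-07's
`WSlotThree.hW_three_of_T2Shape`, leaf-19's `T2SlotOfHW.hW_iff_t2Shape`; the sup-rate ∕ «T2Drift» — NOT IN PRINT, OPEN); the identification is
row D1's object, asserted nowhere; NOT «W-slot closed», NEVER «G-an2-4 closed», NOT (CONV-C); NOT BetaPertH, NOT continuum, NOT Clay. -/
theorem d1Drift_JsBalOf_iff_three_of_hW_supRate (hLc : 2 ≤ Lc) (cE cVH cΛ : ℝ)
    (W : ℕ → Fin (3 + 1) → (Fin (3 + 1) → ℤ) → Fin (3 + 1) → (Fin (3 + 1) → ℤ) → MKer (3 + 1) (Fib 3))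
    (Cw' δw : ℕ → ℝ) (hδw : ∀ j, 0 < δw j) (hW' : ∀ j, VertexFamily₂ (W j) Lc (Cw' j) (δw j)) {Cw δW c θ : ℝ}
    (hW₂ : ∀ j, VertexFamily₂ (unitW (sfStep Lc j) (smStep 3 Lc j) (W j)) Lc Cw δW)
    (hR : ∀ (j : ℕ) (μ : Fin (3 + 1)) (y : Fin (3 + 1) → ℤ) (ν : Fin (3 + 1)) (y' : Fin (3 + 1) → ℤ),
      SupBound (unitW (sfStep Lc (j + 1)) (smStep 3 Lc (j + 1)) (W (j + 1)) μ y ν y' -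
        unitW (sfStep Lc j) (smStep 3 Lc j) (W j) μ y ν y') (c * θ ^ j))
    (hc : 0 ≤ c) (hθ0 : 0 ≤ θ) (hθ1 : θ < 1) (hδW : 0 < δW) (μ ν : Fin 4) (N : ℝ) :
    D1Drift Lc (JsBalOf (one_le_of_two_le hLc) cE cVH cΛ W Cw' δw hδw hW') N μ ν ↔
      B12Beta.secondMoment (hessKer (axDressK Lc (limMKerOf fun j => unitK (sfStep Lc j) (smStep 3 Lc j) (KInvStep (d := 3) Lc j)))
        (axVertexOfK (limMKerOf fun j => unitK (sfStep Lc j) (smStep 3 Lc j) (KInvStep (d := 3) Lc j)) Lc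
          (limStOf fun j => unitS (sfStep Lc j) (smStep 3 Lc j) (JsBal0Of (one_le_of_two_le hLc) cE cVH cΛ W Cw' δw hδw hW' j).S))
        (limTabOf fun j => unitW (sfStep Lc j) (smStep 3 Lc j) (W j))) μ ν = B12Normalization.stepBal N Lc :=
  d1Drift_JsBalOf_iff_three_of_sBlock_hW_supRate hLc cE cVH cΛ W Cw' δw hδw hW'
    (hS_hSall_three (Lc := Lc) hLc cE cVH cΛ W Cw' δw hδw hW') hW₂ hR hc hθ0 hθ1 hδW μ ν N

end Summit.QuantumFields.BalabanUV.Beta.GAN24.WSlotSupRateWall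

end
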